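import Summits.Langlands.Langlands.Theorems.ParityBlindBianchiTwoAdicBianchiProModularityLevelSqueezeDefs
import Summits.Langlands.Langlands.Theorems.ParityBlindBianchiTwoAdicBianchiProModularityLevelSqueezeArtinTypePoint
import Literature.NumberTheory.GaloisRepresentations.IntegralGaloisActionProofs
import HarnessLib

/-!
# Line `dimension-squeeze` (crux `TwoAdicBianchiProModularityLevel`, stmt-Langlands-15110): the
# read-out `stub_zariskiReadout` (READ) reduced to "the type-`θ` Hecke points are Zariski closed"

Vocabulary (`Model`, `pointRep`, `typePoints`, `typeLocusIdeal`, `heckePoints`, `heckeIdeal`,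
`IsAssocBare`, `IsPointAt`, `O2`, `Good`, `badSet`) is the landed Defs file of the checked skeleton
`Cruxes/TwoAdicBianchiProModularityLevel/Lines/dimension_squeeze.lean` (v2); the Artin type point is
the landed `squeeze_exists_artinTypePoint`.  Nothing is assumed; no definition is introduced.

READ says: if `J_U ≤ I^θ` (every function on `Spec R` vanishing at the type-`θ` Hecke points of
level `U` vanishes on the whole type-`θ` locus) then the Hansen data `a` of `σ` ARE a point of
`Spf 𝕋(U²)`.  Its proof in print has a `σ`-free Hecke half and a `σ`-specific Galois half:

* HECKE HALF (named-fact-sized, NOT proved here): **the type-`θ` Hecke points of level `U` are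
  Zariski closed among the type-`θ` points** — a type point `x : R → 𝒪_{ℚ̄₂}` killing
  `J_U = ⋂_{φ Hecke} ker φ` is itself a Hecke point.  In print: Scholze's `𝕋(U²)_𝔪`-valued
  determinant [Scholze2015, Thm. V.4.1, Cor. V.4.2] made a representation by Chenevier's theorem
  (absolutely irreducible `σ̄`), Mazur universality `q : R ↠ 𝕋_𝔪`, every Hecke point factors
  through `q` (Carayol + automatic continuity, `Literature…PadicAlgClPointsAutomaticContinuity`),
  so `ker q ≤ J_U ≤ ker x` and `x` factors through `𝕋_𝔪`, continuously — i.e. `x` is a Hecke point.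
  `squeeze_heckePointsClosed_of_heckeQuotient` isolates the formal residue: it suffices to have ANY
  surjection `q : R ↠ T` with `ker q ≤ J_U` (every Hecke point factors through `T`) all of whose
  `𝒪_{ℚ̄₂}`-points lying over type points are Hecke points — the same data `(T, q)` as the lead's
  AUT lemma `squeeze_heckeDimension_of_heckeAlgebra`, plus the inclusion `ker q ≤ J_U`.
* GALOIS HALF (proved here): the Artin point `x_σ = emb ∘ φ_σ` is a type point
  (`squeeze_exists_artinTypePoint`), its Galois representation `x_σ ∘ ρ^univ` is CONJUGATE to `σ`
  (`Model.pointRep_artin_apply`: strict equivalence with `σ_𝒪`, then `σ_𝒪 ↦ P⁻¹ σ P`), hence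
  Hansen-associated with the same data `a` at every good place (`Model.isAssocBare_pointRep_artin`);
  association data are unique at `i = 1, 2` (`IsAssocBare.eq_of_isAssocBare`: a Frobenius exists
  at every place, `q_v ≠ 0` in `ℚ̄₂`), and `IsPointAt` only reads `i = 1, 2`
  (`isPointAt_congr`).

Whence `squeeze_zariskiReadout_of_heckePointsClosed` (registered sub-goal; **READ ⇐ HECKE HALF**,
all other hypotheses of the registered stub being consumed or superfluous),
`stub_zariskiReadout_of_heckePointsClosed` (the registered stub `stub_zariskiReadout` VERBATIM from
the Hecke half stated globally over tame levels), `squeeze_zariskiReadout_of_heckeQuotient`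
(**READ ⇐ a Hecke quotient `(T, q)` with `ker q ≤ J_U`**) and `squeeze_zariskiReadout_of_heckeAlgebra`
(the same with the `𝒪`-algebra data `(T, q, hHecke)` of the AUT lemma
`squeeze_heckeDimension_of_heckeAlgebra` verbatim, plus `ker q ≤ J_U`).

References: P. Scholze, Ann. of Math. 182 (2015), §V.4 [cite: Scholze2015, §V.4];
B. Mazur (1997), §20 Prop. 2 [cite: Mazur1997Deformation, §20 Prop. 2];
D. Hansen, *Universal eigenvarieties…* (2017), Def. 1.2.1 [cite: HansenUniversalEigenvarieties2017, Def. 1.2.1].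
-/

noncomputable section

set_option linter.dupNamespace false -- `Summit.Langlands.Langlands` is the mandated namespace (D-0017)

open scoped NumberField MatrixGroups
open Polynomial IsDedekindDomain Field
open Literature.NumberTheory.GaloisRepresentations Literature.NumberTheory.Automorphic

namespace Summit.Langlands.Langlands.Cruxes.TwoAdicBianchiProModularityLevel.DimensionSqueeze

/-! ### Hansen association for bare homomorphisms: conjugation invariance and uniqueness -/

section Assoc

variable {K : Type} [Field K] [NumberField K]

/-- Hansen's polynomial in rank `2`: `heckeFrobPoly q 2 t = t₀ X² − t₁ X + q t₂` (private copy of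
the tree's `heckeFrobPoly_two`). [folklore] -/
private theorem heckeFrobPoly_two' {A : Type*} [CommRing A] (q : ℕ) (t : ℕ → A) :
    heckeFrobPoly q 2 t = C (t 0) * X ^ 2 - C (t 1) * X + C ((q : A) * t 2) := by
  simp only [heckeFrobPoly, Finset.sum_range_succ, Finset.sum_range_zero]
  simp only [map_mul]
  norm_num
  ring

/-- **Bare association is invariant under conjugation**: if `ρ` is Hansen-associated with `t` at
`v`, so is `g ↦ Q⁻¹ ρ(g) Q` (unramifiedness and characteristic polynomials are conjugation
invariant). [folklore] -/
theorem IsAssocBare.conj {ρ ρ' : absoluteGaloisGroup K →* GL (Fin 2) (PadicAlgCl 2)}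
    (Q : GL (Fin 2) (PadicAlgCl 2)) (hρ' : ∀ g, ρ' g = Q⁻¹ * ρ g * Q) {v : HeightOneSpectrum (𝓞 K)}
    {t : ℕ → PadicAlgCl 2} (h : IsAssocBare K ρ v t) : IsAssocBare K ρ' v t := by
  refine ⟨fun 𝔓 h𝔓 g hg => ?_, fun 𝔓 h𝔓 g hg => ?_⟩
  · rw [hρ', h.1 𝔓 h𝔓 g hg, mul_one, inv_mul_cancel]
  · rw [hρ', Units.val_mul, Units.val_mul, Matrix.coe_units_inv, ← h.2 𝔓 h𝔓 g hg]
    exact Matrix.charpoly_units_conj' Q _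

/-- **Association data are unique in degrees `1` and `2`**: if `ρ` is Hansen-associated at `v`
with both `t` and `t'`, then `t 1 = t' 1` and `t 2 = t' 2` — compare the coefficients of
`X² − t₁ X + q_v t₂` at an arithmetic Frobenius (which exists at every prime above `v`,
`exists_isArithFrobAt_of_mem_primesAbove_holds`), using `q_v ≠ 0` in `ℚ̄₂`. [folklore] -/
theorem IsAssocBare.eq_of_isAssocBare {ρ : absoluteGaloisGroup K →* GL (Fin 2) (PadicAlgCl 2)}
    {v : HeightOneSpectrum (𝓞 K)} {t t' : ℕ → PadicAlgCl 2} (h : IsAssocBare K ρ v t)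
    (h' : IsAssocBare K ρ v t') : t 1 = t' 1 ∧ t 2 = t' 2 := by
  obtain ⟨𝔓, h𝔓⟩ := v.primesAbove_nonempty
  obtain ⟨g, hg⟩ := HeightOneSpectrum.exists_isArithFrobAt_of_mem_primesAbove_holds h𝔓
  have hP : heckeFrobPoly v.residueCard 2 t = heckeFrobPoly v.residueCard 2 t' := by
    rw [← h.2 𝔓 h𝔓 g hg, ← h'.2 𝔓 h𝔓 g hg]
  rw [heckeFrobPoly_two', heckeFrobPoly_two'] at hP
  have h1 := congrArg (fun P : (PadicAlgCl 2)[X] => P.coeff 1) hP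
  have h0 := congrArg (fun P : (PadicAlgCl 2)[X] => P.coeff 0) hP
  simp only [coeff_add, coeff_sub, coeff_C_mul, coeff_X_pow, coeff_X_one, coeff_X_zero, coeff_C,
    if_true, mul_one, mul_zero] at h1 h0
  norm_num at h1 h0
  have hq : v.residueCard ≠ 0 := by
    have : 1 < v.residueCard := v.one_lt_residueCard
    omega
  exact ⟨h1, h0.resolve_right hq⟩

end Assoc

/-! ### The Galois representation of the Artin point is conjugate to `σ` -/

namespace Model

variable {K : Type} [Field K] [NumberField K] {σ : FramedGaloisRep K (PadicAlgCl 2) 2} (M : Model σ)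
  {S₀ : Finset ℕ} {h0 : (0 : ℕ) ∉ S₀} {h2 : 2 ∈ S₀}
  {hunr : ∀ v ∉ badSet K S₀, Deformation.IsUnramifiedAt v M.residual}

/-- **The Galois representation of the Artin point is conjugate to `σ`.**  If `φ ∘ ρ^univ` is
strictly equivalent to `σ_𝒪` (`σ_𝒪 = P · (φ ∘ ρ^univ) · P⁻¹`) then, pushing to `ℚ̄₂` and using
`σ_𝒪 ↦ F⁻¹ σ F` (`Model.map_σ𝒪`), the representation of the point `emb ∘ φ` is
`g ↦ Q⁻¹ σ(g) Q` with `Q = F · P̄`, `P̄` the image of `P` in `GL₂(ℚ̄₂)`. [folklore] -/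
theorem pointRep_artin_apply (𝓡 : PolarizedDeformationRing (M.datum S₀ h0 h2 hunr))
    (φ : 𝓡.R →ₐ[M.𝒪] M.𝒪) {P : GL (Fin 2) M.𝒪}
    (hP : ∀ g, M.σ𝒪 g = P * ((Matrix.GeneralLinearGroup.map (φ : 𝓡.R →+* M.𝒪)).comp 𝓡.ρ) g * P⁻¹)
    (g : absoluteGaloisGroup K) :
    M.pointRep 𝓡 (M.emb.comp (φ : 𝓡.R →+* M.𝒪)) g =
      (M.frame * Matrix.GeneralLinearGroup.map (O2.incl.comp M.emb) P)⁻¹ * σ g *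
        (M.frame * Matrix.GeneralLinearGroup.map (O2.incl.comp M.emb) P) := by
  have hφg : (Matrix.GeneralLinearGroup.map (φ : 𝓡.R →+* M.𝒪)) (𝓡.ρ g) = P⁻¹ * M.σ𝒪 g * P := by
    have := hP g
    rw [MonoidHom.comp_apply] at this
    rw [this]; group
  have hmap : M.pointRep 𝓡 (M.emb.comp (φ : 𝓡.R →+* M.𝒪)) g =
      Matrix.GeneralLinearGroup.map (O2.incl.comp M.emb)
        ((Matrix.GeneralLinearGroup.map (φ : 𝓡.R →+* M.𝒪)) (𝓡.ρ g)) := by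
    rw [pointRep, MonoidHom.comp_apply, ← RingHom.comp_assoc, Matrix.GeneralLinearGroup.map_comp]
    rfl
  rw [hmap, hφg, map_mul, map_mul, map_inv, M.map_σ𝒪 g]
  group

/-- **The Artin point is Hansen-associated with the data of `σ`**: with `φ` as in
`squeeze_exists_artinTypePoint`, `(emb ∘ φ) ∘ ρ^univ` is conjugate to `σ`, so
`σ.IsHeckeAssociatedAt v t` gives `IsAssocBare K (pointRep (emb ∘ φ)) v t`.
[cite: HansenUniversalEigenvarieties2017, Def. 1.2.1] -/
theorem isAssocBare_pointRep_artin (𝓡 : PolarizedDeformationRing (M.datum S₀ h0 h2 hunr))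
    (φ : 𝓡.R →ₐ[M.𝒪] M.𝒪)
    (hφ : Deformation.IsStrictEquiv (algebraMap M.𝒪 M.k)
      ((Matrix.GeneralLinearGroup.map (φ : 𝓡.R →+* M.𝒪)).comp 𝓡.ρ) M.σ𝒪)
    {v : HeightOneSpectrum (𝓞 K)} {t : ℕ → PadicAlgCl 2} (hσ : σ.IsHeckeAssociatedAt v t) :
    IsAssocBare K (M.pointRep 𝓡 (M.emb.comp (φ : 𝓡.R →+* M.𝒪))) v t := by
  obtain ⟨P, -, hP⟩ := hφ
  have hbare : IsAssocBare K σ.toMonoidHom v t :=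
    ⟨(FramedGaloisRep.isUnramifiedAt_iff_toMonoidHom v σ).mp hσ.1, fun 𝔓 h𝔓 g hg => hσ.2 𝔓 h𝔓 g hg⟩
  exact hbare.conj _ (fun g => M.pointRep_artin_apply 𝓡 φ hP g)

end Model

/-! ### `IsPointAt` only reads the degrees `1` and `2` -/

/-- `IsPointAt K S₀ U ϖ b` depends only on the values `b w 1`, `b w 2` (the Hecke family is indexed
by `Good K S₀ × Fin 2`, `j ↦ b j.1 (j.2 + 1)`). [folklore] -/
theorem isPointAt_congr {K : Type} [Field K] [NumberField K] {S₀ : Finset ℕ}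
    {U : Subgroup (GL (Fin 2) (FiniteAdeleRing (𝓞 K) K))}
    {ϖ : ∀ v : HeightOneSpectrum (𝓞 K), (v.adicCompletion K)ˣ} {b b' : Good K S₀ → ℕ → O2}
    (h : ∀ w : Good K S₀, b w 1 = b' w 1 ∧ b w 2 = b' w 2) (hb' : IsPointAt K S₀ U ϖ b') :
    IsPointAt K S₀ U ϖ b := by
  have hfun : (fun j : Good K S₀ × Fin 2 => b j.1 (j.2.val + 1)) =
      fun j : Good K S₀ × Fin 2 => b' j.1 (j.2.val + 1) := by
    funext j
    obtain ⟨w, i⟩ := j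
    fin_cases i
    · exact (h w).1
    · exact (h w).2
  unfold IsPointAt
  rw [hfun]
  exact hb'

/-! ### READ from the Hecke half -/

/-- **READ ⇐ "the type-`θ` Hecke points of level `U` are Zariski closed among the type points".**
If every type-`θ` point `x : R → 𝒪_{ℚ̄₂}` with `J_U ≤ ker x` is a Hecke point of level `U`
(hypothesis `hclosed`: the HECKE HALF of READ, in print Scholze V.4.1 + Chenevier + Mazur
universality + automatic continuity), then `J_U ≤ I^θ` forces the Hansen data `a` of `σ` to be a
point of `Spf 𝕋(U²)`: the Artin point `x_σ` is a type point (`squeeze_exists_artinTypePoint`), so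
`J_U ≤ I^θ ≤ ker x_σ` and `x_σ` is a Hecke point, with data `b` associated with `x_σ ∘ ρ^univ`;
but `x_σ ∘ ρ^univ` is conjugate to `σ`, hence also associated with `a`, so `b = a` in degrees
`1, 2` and `a` is a point.  (The hypotheses of the registered `stub_zariskiReadout` not listed here —
`K` imaginary quadratic, `σ` of finite image and irreducible, `ϖ` uniformisers, `U` tame — are not
needed for this step.) [cite: Mazur1997Deformation, §20 Prop. 2] -/
theorem squeeze_zariskiReadout_of_heckePointsClosed : ∀ (K : Type) [Field K] [NumberField K]
    (σ : FramedGaloisRep K (PadicAlgCl 2) 2) (S₀ : Finset ℕ) (h0 : (0 : ℕ) ∉ S₀) (h2 : 2 ∈ S₀)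
    (ϖ : ∀ v : HeightOneSpectrum (𝓞 K), (v.adicCompletion K)ˣ) (a : Good K S₀ → ℕ → O2),
    (∀ (v : HeightOneSpectrum (𝓞 K)) (hv : ∀ ℓ ∈ S₀, ((ℓ : ℕ) : 𝓞 K) ∉ v.asIdeal),
      σ.IsHeckeAssociatedAt v
        (fun i : ℕ => if i = 0 then (1 : PadicAlgCl 2) else (a ⟨v, hv⟩ i : PadicAlgCl 2))) →
    ∀ (M : Model σ) (hunr : ∀ v ∉ badSet K S₀, Deformation.IsUnramifiedAt v M.residual)
      (𝓡 : PolarizedDeformationRing (M.datum S₀ h0 h2 hunr))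
      (U : Subgroup (GL (Fin 2) (FiniteAdeleRing (𝓞 K) K))),
    (∀ x ∈ M.typePoints 𝓡, M.heckeIdeal 𝓡 U ϖ ≤ RingHom.ker x → x ∈ M.heckePoints 𝓡 U ϖ) →
    M.heckeIdeal 𝓡 U ϖ ≤ M.typeLocusIdeal 𝓡 → IsPointAt K S₀ U ϖ a := by
  intro K _ _ σ S₀ h0 h2 ϖ a hassoc M hunr 𝓡 U hclosed hle
  -- the Artin point `x_σ = emb ∘ φ` is a type point, hence (by `hle`) a Hecke point
  obtain ⟨φ, hφ, htype⟩ := squeeze_exists_artinTypePoint K σ S₀ h0 h2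
    (fun v hv => (hassoc v hv).isUnramifiedAt) M hunr 𝓡
  have hker : M.heckeIdeal 𝓡 U ϖ ≤ RingHom.ker (M.emb.comp (φ : 𝓡.R →+* M.𝒪)) :=
    hle.trans (iInf₂_le _ htype)
  obtain ⟨-, b, hb, hbpt⟩ := hclosed _ htype hker
  -- its data `b` agree with `a` in degrees `1, 2`
  refine isPointAt_congr (fun w => ?_) hbpt
  have ha : IsAssocBare K (M.pointRep 𝓡 (M.emb.comp (φ : 𝓡.R →+* M.𝒪))) w.1
      (fun i : ℕ => if i = 0 then (1 : PadicAlgCl 2) else (a ⟨w.1, w.2⟩ i : PadicAlgCl 2)) :=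
    M.isAssocBare_pointRep_artin 𝓡 φ hφ (hassoc w.1 w.2)
  obtain ⟨h1, h2'⟩ := ha.eq_of_isAssocBare (hb w.1 w.2)
  simp only [one_ne_zero, if_false, OfNat.ofNat_ne_zero] at h1 h2'
  exact ⟨Subtype.ext h1, Subtype.ext h2'⟩

/-- **The registered stub `stub_zariskiReadout` (READ, verbatim) from its HECKE HALF stated
globally** (hypothesis `hclosed`: for every admissible `K, σ, S₀, ϖ, M, 𝓡` and every TAME level
`U`, the type-`θ` Hecke points of level `U` are Zariski closed among the type points — the
named-fact-sized input: Scholze V.4.1 + Chenevier + Mazur universality + automatic continuity).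
The remaining hypotheses of READ are passed through or dropped. [cite: Scholze2015, §V.4] -/
theorem stub_zariskiReadout_of_heckePointsClosed
    (hclosed : ∀ (K : Type) [Field K] [NumberField K], NumberField.IsTotallyComplex K →
      Module.finrank ℚ K = 2 →
      ∀ (σ : FramedGaloisRep K (PadicAlgCl 2) 2),
      Finite σ.toMonoidHom.range → σ.toGaloisRep.IsIrreducible →
      ∀ (S₀ : Finset ℕ) (h0 : (0 : ℕ) ∉ S₀) (h2 : 2 ∈ S₀)
        (ϖ : ∀ v : HeightOneSpectrum (𝓞 K), (v.adicCompletion K)ˣ),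
      (∀ v : HeightOneSpectrum (𝓞 K),
        Valued.v ((ϖ v : (v.adicCompletion K)ˣ) : v.adicCompletion K) = WithZero.exp (-1 : ℤ)) →
      ∀ (M : Model σ) (hunr : ∀ v ∉ badSet K S₀, Deformation.IsUnramifiedAt v M.residual)
        (𝓡 : PolarizedDeformationRing (M.datum S₀ h0 h2 hunr))
        (U : Subgroup (GL (Fin 2) (FiniteAdeleRing (𝓞 K) K))), IsTameLevel K S₀ U →
      ∀ x ∈ M.typePoints 𝓡, M.heckeIdeal 𝓡 U ϖ ≤ RingHom.ker x → x ∈ M.heckePoints 𝓡 U ϖ) :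
    ∀ (K : Type) [Field K] [NumberField K], NumberField.IsTotallyComplex K →
    Module.finrank ℚ K = 2 →
    ∀ (σ : FramedGaloisRep K (PadicAlgCl 2) 2),
    Finite σ.toMonoidHom.range → σ.toGaloisRep.IsIrreducible →
    ∀ (S₀ : Finset ℕ) (h0 : (0 : ℕ) ∉ S₀) (h2 : 2 ∈ S₀)
      (ϖ : ∀ v : HeightOneSpectrum (𝓞 K), (v.adicCompletion K)ˣ),
    (∀ v : HeightOneSpectrum (𝓞 K),
      Valued.v ((ϖ v : (v.adicCompletion K)ˣ) : v.adicCompletion K) = WithZero.exp (-1 : ℤ)) →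
    ∀ (a : Good K S₀ → ℕ → O2),
    (∀ (v : HeightOneSpectrum (𝓞 K)) (hv : ∀ ℓ ∈ S₀, ((ℓ : ℕ) : 𝓞 K) ∉ v.asIdeal),
      σ.IsHeckeAssociatedAt v (fun i : ℕ => if i = 0 then (1 : PadicAlgCl 2) else (a ⟨v, hv⟩ i : PadicAlgCl 2))) →
    ∀ (M : Model σ) (hunr : ∀ v ∉ badSet K S₀, Deformation.IsUnramifiedAt v M.residual)
      (𝓡 : PolarizedDeformationRing (M.datum S₀ h0 h2 hunr))
      (U : Subgroup (GL (Fin 2) (FiniteAdeleRing (𝓞 K) K))), IsTameLevel K S₀ U →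
    M.heckeIdeal 𝓡 U ϖ ≤ M.typeLocusIdeal 𝓡 → IsPointAt K S₀ U ϖ a := by
  intro K _ _ htc hdeg σ hfin hirr S₀ h0 h2 ϖ hϖ a hassoc M hunr 𝓡 U hU hle
  exact squeeze_zariskiReadout_of_heckePointsClosed K σ S₀ h0 h2 ϖ a hassoc M hunr 𝓡 U
    (hclosed K htc hdeg σ hfin hirr S₀ h0 h2 ϖ hϖ M hunr 𝓡 U hU) hle

/-! ### The Hecke half from a Hecke quotient of `R` -/

/-- **The Hecke points are Zariski closed as soon as they all factor through a quotient of `R`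
whose points over type points are Hecke points.**  If `q : R ↠ T` is a surjection with
`ker q ≤ J_U` (every type-`θ` Hecke point of level `U` factors through `T`) such that every
`ψ : T → 𝒪_{ℚ̄₂}` with `ψ ∘ q` a type point has `ψ ∘ q` a Hecke point, then every type point
killing `J_U` is a Hecke point (it kills `ker q`, so factors through `T`,
`RingHom.liftOfSurjective`).  Intended `T = 𝕋^θ(U²)_𝔪` with Scholze–Chenevier–Carayol's
`q : R ↠ 𝕋_𝔪` — the data of the lead's AUT lemma `squeeze_heckeDimension_of_heckeAlgebra`.
[cite: Scholze2015, §V.4] -/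
theorem squeeze_heckePointsClosed_of_heckeQuotient {K : Type} [Field K] [NumberField K]
    {σ : FramedGaloisRep K (PadicAlgCl 2) 2} (M : Model σ) {S₀ : Finset ℕ} {h0 : (0 : ℕ) ∉ S₀}
    {h2 : 2 ∈ S₀} {hunr : ∀ v ∉ badSet K S₀, Deformation.IsUnramifiedAt v M.residual}
    (𝓡 : PolarizedDeformationRing (M.datum S₀ h0 h2 hunr))
    (U : Subgroup (GL (Fin 2) (FiniteAdeleRing (𝓞 K) K)))
    (ϖ : ∀ v : HeightOneSpectrum (𝓞 K), (v.adicCompletion K)ˣ)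
    {T : Type*} [CommRing T] (q : 𝓡.R →+* T) (hq : Function.Surjective q)
    (hqJ : RingHom.ker q ≤ M.heckeIdeal 𝓡 U ϖ)
    (hT : ∀ ψ : T →+* O2, ψ.comp q ∈ M.typePoints 𝓡 → ψ.comp q ∈ M.heckePoints 𝓡 U ϖ) :
    ∀ x ∈ M.typePoints 𝓡, M.heckeIdeal 𝓡 U ϖ ≤ RingHom.ker x → x ∈ M.heckePoints 𝓡 U ϖ := by
  intro x hx hJx
  set ψ : T →+* O2 := q.liftOfSurjective hq ⟨x, hqJ.trans hJx⟩ with hψ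
  have hψq : ψ.comp q = x := q.liftOfSurjective_comp hq ⟨x, hqJ.trans hJx⟩
  rw [← hψq] at hx ⊢
  exact hT ψ hx

/-- **READ ⇐ a Hecke quotient `(T, q)` of `R` with `ker q ≤ J_U`** (composition of
`squeeze_heckePointsClosed_of_heckeQuotient` and `squeeze_zariskiReadout_of_heckePointsClosed`):
given, for the level `U`, a surjection `q : R ↠ T` through which every type-`θ` Hecke point
factors and whose `𝒪_{ℚ̄₂}`-points over type points are Hecke points, `J_U ≤ I^θ` implies that the
Hansen data of `σ` are a point of `Spf 𝕋(U²)`. [cite: Scholze2015, §V.4] -/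
theorem squeeze_zariskiReadout_of_heckeQuotient : ∀ (K : Type) [Field K] [NumberField K]
    (σ : FramedGaloisRep K (PadicAlgCl 2) 2) (S₀ : Finset ℕ) (h0 : (0 : ℕ) ∉ S₀) (h2 : 2 ∈ S₀)
    (ϖ : ∀ v : HeightOneSpectrum (𝓞 K), (v.adicCompletion K)ˣ) (a : Good K S₀ → ℕ → O2),
    (∀ (v : HeightOneSpectrum (𝓞 K)) (hv : ∀ ℓ ∈ S₀, ((ℓ : ℕ) : 𝓞 K) ∉ v.asIdeal),
      σ.IsHeckeAssociatedAt v
        (fun i : ℕ => if i = 0 then (1 : PadicAlgCl 2) else (a ⟨v, hv⟩ i : PadicAlgCl 2))) →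
    ∀ (M : Model σ) (hunr : ∀ v ∉ badSet K S₀, Deformation.IsUnramifiedAt v M.residual)
      (𝓡 : PolarizedDeformationRing (M.datum S₀ h0 h2 hunr))
      (U : Subgroup (GL (Fin 2) (FiniteAdeleRing (𝓞 K) K)))
      (T : Type) [CommRing T] (q : 𝓡.R →+* T), Function.Surjective q →
    RingHom.ker q ≤ M.heckeIdeal 𝓡 U ϖ →
    (∀ ψ : T →+* O2, ψ.comp q ∈ M.typePoints 𝓡 → ψ.comp q ∈ M.heckePoints 𝓡 U ϖ) →
    M.heckeIdeal 𝓡 U ϖ ≤ M.typeLocusIdeal 𝓡 → IsPointAt K S₀ U ϖ a := by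
  intro K _ _ σ S₀ h0 h2 ϖ a hassoc M hunr 𝓡 U T _ q hq hqJ hT hle
  exact squeeze_zariskiReadout_of_heckePointsClosed K σ S₀ h0 h2 ϖ a hassoc M hunr 𝓡 U
    (squeeze_heckePointsClosed_of_heckeQuotient M 𝓡 U ϖ q hq hqJ hT) hle

/-- **READ from the data of the lead's AUT lemma `squeeze_heckeDimension_of_heckeAlgebra` plus
`ker q ≤ J_U`.**  For an `𝒪`-algebra surjection `q : R ↠ T` all of whose `𝒪`-algebra points
`ψ : T → 𝒪_{ℚ̄₂}` (`ψ ∘ (𝒪 → T) = emb`) give Hecke points `ψ ∘ q`, and through which every Hecke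
point factors (`ker q ≤ J_U`), `J_U ≤ I^θ` implies that the Hansen data of `σ` are a point of
`Spf 𝕋(U²)` (an `𝒪_{ℚ̄₂}`-point `ψ` of `T` with `ψ ∘ q` a type point is an `𝒪`-algebra point since
`𝒪 → T` factors through `q`). [cite: Scholze2015, §V.4] -/
theorem squeeze_zariskiReadout_of_heckeAlgebra : ∀ (K : Type) [Field K] [NumberField K]
    (σ : FramedGaloisRep K (PadicAlgCl 2) 2) (S₀ : Finset ℕ) (h0 : (0 : ℕ) ∉ S₀) (h2 : 2 ∈ S₀)
    (ϖ : ∀ v : HeightOneSpectrum (𝓞 K), (v.adicCompletion K)ˣ) (a : Good K S₀ → ℕ → O2),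
    (∀ (v : HeightOneSpectrum (𝓞 K)) (hv : ∀ ℓ ∈ S₀, ((ℓ : ℕ) : 𝓞 K) ∉ v.asIdeal),
      σ.IsHeckeAssociatedAt v
        (fun i : ℕ => if i = 0 then (1 : PadicAlgCl 2) else (a ⟨v, hv⟩ i : PadicAlgCl 2))) →
    ∀ (M : Model σ) (hunr : ∀ v ∉ badSet K S₀, Deformation.IsUnramifiedAt v M.residual)
      (𝓡 : PolarizedDeformationRing (M.datum S₀ h0 h2 hunr))
      (U : Subgroup (GL (Fin 2) (FiniteAdeleRing (𝓞 K) K)))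
      (T : Type) [CommRing T] [Algebra M.𝒪 T] (q : 𝓡.R →ₐ[M.𝒪] T), Function.Surjective q →
    RingHom.ker (q : 𝓡.R →+* T) ≤ M.heckeIdeal 𝓡 U ϖ →
    (∀ ψ : T →+* O2, ψ.comp (algebraMap M.𝒪 T) = M.emb →
      ψ.comp (q : 𝓡.R →+* T) ∈ M.heckePoints 𝓡 U ϖ) →
    M.heckeIdeal 𝓡 U ϖ ≤ M.typeLocusIdeal 𝓡 → IsPointAt K S₀ U ϖ a := by
  intro K _ _ σ S₀ h0 h2 ϖ a hassoc M hunr 𝓡 U T _ _ q hq hqJ hHecke hle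
  refine squeeze_zariskiReadout_of_heckeQuotient K σ S₀ h0 h2 ϖ a hassoc M hunr 𝓡 U T
    (q : 𝓡.R →+* T) hq hqJ (fun ψ hψ => hHecke ψ ?_) hle
  -- `ψ ∘ (𝒪 → T) = (ψ ∘ q) ∘ (𝒪 → R) = emb`
  rw [← hψ.1, RingHom.comp_assoc]
  congr 1
  exact RingHom.ext fun y => (q.commutes y).symm

end Summit.Langlands.Langlands.Cruxes.TwoAdicBianchiProModularityLevel.DimensionSqueeze

end
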